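import Literature.NumberTheory.DiophantineGeometry.MinimalDiscriminantProofs
import Mathlib.RingTheory.Ideal.GoingUp
import Summits.ABC.IUTFork.Cor312ProvenanceDH
import HarnessLib

/-!
# [IUTchIII] Cor. 3.12 / [IUTchIV] Thm. 1.10: `log(q) > 0` for EVERY collection of initial Θ-data — PROVED (c312 crew, wave 2, W2-F companion)

Record-only companion (seat abc-iut-c312-8; board row W2-F) of `Cor312Provenance.lean` / `Cor312ProvenanceDH.lean`;
TAKES NO SIDE on Cor. 3.12. Cor. 3.12 (kurims p. 174 l. 11–14): "In particular, `|log(q)| > 0` is easily computed in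
terms of the various `q`-parameters of the elliptic curve `E_F` [cf. [IUTchI], Definition 3.1, (b)] at `v ∈ 𝕍^bad (≠ ∅)`";
[IUTchIV] Thm. 1.10 (p. 23): "`𝕍(F□)^bad := 𝕍^bad_mod ×_{𝕍_mod} 𝕍(F□) (≠ ∅)`", "`log(q) … ∈ ℝ_{≥0}`", "`|log(q)| ∈ ℝ_{>0}`". This
file DISCHARGES the input `Thm110Inputs.logq_pos` / `NumericsInputs.logq_pos` of `Cor312Provenance.lean` from the datum
alone (no Dupuy–Hilado side, no hypothesis): for abc-iut-L5-t2's `InitialThetaData F K Fbar E l Pb`,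
* `vFbad_nonempty` — `𝕍(F)^bad ≠ ∅`: over every finite place of `F_mod` (in particular over the nonempty `𝕍^bad_mod`,
  Def. 3.1 (b)) lies a finite place of `F` (going up in `𝓞_{F_mod} ⊆ 𝓞_F`, Mathlib
  `Ideal.exists_maximal_ideal_liesOver_of_isIntegral`; the same argument as abc-iut-c312-5's
  `Thm311.Real.fibre_restrict_nonempty`, re-proved here universe-polymorphically);
* `one_le_qParamOrd` — at `v ∈ 𝕍(F)^bad`, `ord_v(q_v) = ord_v(Δ_min) ≥ 1`: `E_F` has multiplicative, hence not good,
  reduction there (Def. 3.1 (b), L5-t2's `multiplicative_over_VbadMod`), and `ord_v(Δ_min) = 0 ⟺` good reduction is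
  the tree's DISCHARGED classical fact `WeierstrassCurve.ordMinimalDiscriminant_eq_zero_iff_holds` (Silverman AEC VII.5.1(a));
* **`logq_pos` — `log(q) > 0`**, and `absLogq_pos` — `|log(q)| > 0`; whence `absLogQPos_ofSetting`: c312-7's printed clause
  `Cor312.Setting.AbsLogQPos` holds for EVERY setting linked to `D` by `IsSettingOf`, and `Thm110Inputs.ofData` /
  `NumericsInputs.ofData` need only the [IUTchIV]-side numbers.
[claim: Mochizuki2012, status: disputed] for the quotations; the theorems are PROVED.
-/

noncomputable section

namespace Summit.ABC.IUTFork.Cor312Prov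

open Literature.IUT.HodgeTheaters Literature.IUT.LogVolume NumberField IsDedekindDomain

universe u v w

variable {F : Type u} {K : Type v} {Fbar : Type w} [Field F] [NumberField F] [Field K] [NumberField K]
  [Algebra F K] [Field Fbar] [Algebra F Fbar] [Algebra K Fbar] {E : WeierstrassCurve F} [E.IsElliptic]
  {l : ℕ} {Pb : BadPlacePredicates K}

/-- Over every finite place `w` of `F_mod = ℚ(j_E)` lies a finite place `v` of `F`, i.e. one whose restriction
(L5-t2's `Val.restrict`, [IUTchI] Def. 3.1 (e) "the natural surjection") is `w`. PROVED (going up for the integral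
extension `𝓞_{F_mod} ⊆ 𝓞_F`). [folklore] -/
theorem exists_finitePlace_over (w : FinitePlace (fieldOfModuli E)) :
    ∃ v : FinitePlace F, Val.restrict (fieldOfModuli E) (Val.non v) = Val.non w := by
  haveI := (FinitePlace.maximalIdeal w).isMaximal
  haveI : FaithfulSMul (𝓞 (fieldOfModuli E)) (𝓞 F) :=
    (faithfulSMul_iff_algebraMap_injective (𝓞 (fieldOfModuli E)) (𝓞 F)).mpr
      (RingOfIntegers.algebraMap.injective (fieldOfModuli E) F)
  obtain ⟨P, hP, hPover⟩ :=
    Ideal.exists_maximal_ideal_liesOver_of_isIntegral (S := 𝓞 F) (FinitePlace.maximalIdeal w).asIdeal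
  have hPne : P ≠ ⊥ := Ideal.ne_bot_of_liesOver_of_ne_bot (FinitePlace.maximalIdeal w).ne_bot P
  let v : HeightOneSpectrum (𝓞 F) := ⟨P, hP.isPrime, hPne⟩
  have hv : v.under (𝓞 (fieldOfModuli E)) = FinitePlace.maximalIdeal w :=
    HeightOneSpectrum.ext hPover.over.symm
  refine ⟨FinitePlace.mk v, ?_⟩
  show Sum.inr (FinitePlace.mk ((FinitePlace.maximalIdeal (FinitePlace.mk v)).under (𝓞 (fieldOfModuli E))))
      = Sum.inr w
  rw [FinitePlace.maximalIdeal_mk, hv, FinitePlace.mk_maximalIdeal]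

/-- **`𝕍(F)^bad ≠ ∅`** ([IUTchIV] p. 23 "`(≠ ∅)`"; Cor. 3.12 "`v ∈ 𝕍^bad (≠ ∅)`"): `𝕍^bad_mod` is nonempty (Def. 3.1 (b), L5-t2's
`VbadMod_nonempty`) and places extend. PROVED. [claim: Mochizuki2012, status: disputed] -/
theorem vFbad_nonempty (D : InitialThetaData F K Fbar E l Pb) : D.VFbad.Nonempty := by
  obtain ⟨w, hw⟩ := D.VbadMod_nonempty
  obtain ⟨v, hv⟩ := exists_finitePlace_over (E := E) w
  exact ⟨v, by show Val.restrict (fieldOfModuli E) (Val.non v) ∈ Val.non '' D.VbadMod; rw [hv]; exact ⟨w, hw, rfl⟩⟩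

/-- **`ord_v(q_v) ≥ 1` at `v ∈ 𝕍(F)^bad`**: `ord_v(q_v) := ord_v(Δ_min)` (L5-t2's `qParamOrd`, Tate uniformisation) and `E_F` has
multiplicative — hence not good — reduction at `v` (Def. 3.1 (b)), while `ord_v(Δ_min) = 0 ⟺` good reduction (Silverman AEC
VII.5.1(a), the tree's discharged `WeierstrassCurve.ordMinimalDiscriminant_eq_zero_iff_holds`). PROVED.
[claim: Mochizuki2012, status: disputed] -/
theorem one_le_qParamOrd (D : InitialThetaData F K Fbar E l Pb) {v : FinitePlace F} (hv : v ∈ D.VFbad) :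
    1 ≤ qParamOrd E v.maximalIdeal := by
  have hmult := D.multiplicative_over_VbadMod v hv
  have hiff : E.ordMinimalDiscriminant v.maximalIdeal = 0 ↔ E.HasGoodReductionAt v.maximalIdeal :=
    WeierstrassCurve.ordMinimalDiscriminant_eq_zero_iff_holds v.maximalIdeal E
  have hne : E.ordMinimalDiscriminant v.maximalIdeal ≠ 0 :=
    fun h0 => hmult.not_hasGoodReductionAt (hiff.mp h0)
  unfold qParamOrd
  omega

/-- **`log(q) > 0`** for every collection of initial Θ-data ([IUTchIV] p. 23: "`log(q) … ∈ ℝ_{≥0}`" with "`𝕍(F□)^bad … (≠ ∅)`";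
Cor. 3.12: "`|log(q)| > 0`"): the normalized degree of the effective, NONZERO `q`-parameter divisor. PROVED — the input
`Thm110Inputs.logq_pos` / `NumericsInputs.logq_pos` of `Cor312Provenance.lean` is a THEOREM. [claim: Mochizuki2012, status: disputed] -/
theorem logq_pos (D : InitialThetaData F K Fbar E l Pb) : 0 < logq D := by
  have hfin := vFbad_finite D
  rw [logq_eq_ndeg D hfin, FinDivisor.ndeg_apply, qArithDivisor, FinDivisor.deg_sum_of]
  refine div_pos ?_ FinDivisor.finrank_pos
  obtain ⟨v0, hv0⟩ := vFbad_nonempty D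
  have hmem : v0 ∈ hfin.toFinset := hfin.mem_toFinset.mpr hv0
  have hterm : 0 < (qParamOrd E v0.maximalIdeal : ℝ) * logNorm F v0.maximalIdeal :=
    mul_pos (by exact_mod_cast one_le_qParamOrd D hv0) (logNorm_pos F _)
  exact lt_of_lt_of_le hterm
    (Finset.single_le_sum (f := fun v : FinitePlace F => (qParamOrd E v.maximalIdeal : ℝ) * logNorm F v.maximalIdeal)
      (fun v _ => mul_nonneg (Nat.cast_nonneg _) (logNorm_pos F _).le) hmem)

/-- **`|log(q)| = (1/2l)·log(q) > 0`** (Cor. 3.12, p. 174; `l ≥ 5`). PROVED. [claim: Mochizuki2012, status: disputed] -/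
theorem absLogq_pos (D : InitialThetaData F K Fbar E l Pb) : 0 < absLogq D := by
  have hl : (0 : ℝ) < 2 * (l : ℝ) := by
    have : (5 : ℝ) ≤ l := by exact_mod_cast D.five_le_l
    linarith
  exact div_pos (logq_pos D) hl

/-- Cor. 3.12's printed clause "In particular, `|log(q)| > 0`" (c312-7's `Cor312.Setting.AbsLogQPos`) for EVERY setting `P`
that is the situation of `D` (`IsSettingOf D P`) — no further hypothesis. PROVED. [claim: Mochizuki2012, status: disputed] -/
theorem absLogQPos_ofSetting {D : InitialThetaData F K Fbar E l Pb} {T : Thm311.ThetaIndex} {S : Thm311.Situation T}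
    {P : Cor312.Setting S} (hS : IsSettingOf D P) : P.AbsLogQPos :=
  (absLogQPos_iff P hS (le_trans (by norm_num) D.five_le_l)).mpr (logq_pos D)

/-- `Thm110Inputs` from the [IUTchIV]-side numbers alone: `log(q) > 0` is now supplied by `logq_pos`; `l ≥ 7` still an input
here (see `Cor312ProvenanceL.seven_le_l_of_torsion15_fixed` for its discharge from Thm. 1.10's torsion hypothesis).
[claim: Mochizuki2012, status: disputed] -/
def Thm110Inputs.ofData (D : InitialThetaData F K Fbar E l Pb) (h7 : 7 ≤ l) (estar eta logdf : ℝ)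
    (hestar : 0 ≤ estar) (heta : 0 ≤ eta) (hlogdf : 0 ≤ logdf) : Thm110Inputs D where
  seven_le_l := h7
  logq_pos := Summit.ABC.IUTFork.Cor312Prov.logq_pos D
  estar := estar
  estar_nonneg := hestar
  eta := eta
  eta_nonneg := heta
  logdf := logdf
  logdf_nonneg := hlogdf

end Summit.ABC.IUTFork.Cor312Prov

end
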